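import Summits.BirchSwinnertonDyer.BirchSwinnertonDyer.Theorems.EisensteinPrimesBSDpOnCellCOfLZZFact
import HarnessLib

/-!
# Crux 4 `BSDpOnCellC` (stmt-BirchSwinnertonDyer-19034), line b1 skeleton v10: the crux BY NAME read against the
# ROUTE'S OWN support item `PublishedInputs` (stmt-BirchSwinnertonDyer-19037) — which named facts crux 4 consumes
# BEYOND the route's declared published inputs (cell `bsd-eis`, seat `bsd-eis-k5-c4` g11; k5-c4-MEMO-9 §4 F1)

HONEST FRAMING (cell `bsd-eis`, run/shared/lean/pub/bsd-eis/): theorems only (two by-name compositions); nothing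
booked; X2 stays CONSTRUCTION-SHAPED; no label or count moves; BSD is not proved by any of this. Every theorem is
CONDITIONAL on its displayed binders (`conditional-result`): the route decl `PublishedInputs` (the conjunction of 20
published named facts that rung K5's deciding theorem `Theses.EisensteinPrimes.closes` carries as `hP`), SIX further
refereed named facts of the Literature library that are NOT conjuncts of `PublishedInputs` and NOT otherwise items of
`route-BirchSwinnertonDyer-EisensteinPrimes` — Poitou–Tate duality ×2 (Milne ADT I 4.10), Hsieh 2014 Thm. 1 (the
frame), Mazur 1978 Cor. 4.1 (Manin constant at odd `p`), Castella JIMJ 17 (2018) Thms. 2.10–2.11 ([cas-split], the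
value at `p ≥ 5`), Liu–Zhang–Zhang Duke 167 (2018) Thms. 1.5.1/1.5.3 (the value at `p = 3`) —, the PREPRINT claim
Keller–Yin arXiv:2402.12781v2 Thm. D BY NAME (gapped at L1754), and, for the whole cell, crux 3 `MazurMCOnCellB`.

## Why

Crux 4's registered fact stub `stub_publishedFacts` (v10) has 17 unproved conjuncts; 11 of them are conjuncts of the
route's support item `PublishedInputs` (GV 2000 λ/μ, Wuthrich 2014 Thm. 16, Stein–Wuthrich 2013 Thm. 6.1 ×2,
Greenberg–Stevens, newform existence, Gross–Zagier, Kolyvagin, GZK rank, Hoffstein–Luo, Cassels), 6 are not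
(k5-c4-MEMO-9 Table 1). The two theorems below make that reading kernel-visible: they conclude the route decl
`BSDpOnCellC` (resp. its ψ-even strand) from `PublishedInputs` BY NAME plus exactly the six extra facts, the
Keller–Yin binder and (first theorem only) crux 3 — i.e. they are `Reoriented.bsdpOnCellC_of_thm151_thm153_of_thmD_OPEN`
/ `Reoriented.bsdpOnCellCNotGV_of_thm151_thm153_of_thmD_OPEN` (cgshw g15) with the 11 shared conjuncts projected out
of `PublishedInputs` (conjuncts 2, 6, 7, 9, 10, 11, 14, 15, 16, 17, 20 in the route's order).

* `bsdpOnCellC_of_publishedInputs_of_sixFacts_of_thmD_OPEN` — `PublishedInputs` + 6 PUB facts + KY Thm. D + crux 3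
  ⊢ `BSDpOnCellC` BY NAME.
* `bsdpOnCellCNotGV_of_publishedInputs_of_sixFacts_of_thmD_OPEN` — `PublishedInputs` + 6 PUB facts + KY Thm. D
  ⊢ `∀ W p, CellC W p → ¬ GVPar W p → BSDp W p` (no crux 3; the 9 981 ψ-even B11 cells @3 + 409 @5/@7).

What this is NOT: not a proof of Thm. D, of any main conjecture, or of BSD for any curve; not a new road (by-name
re-plumbing of the cgshw g15 doors); no count or tier move. Novel here: nothing mathematical — route-level accounting.

References: [KellerYin2024] Thm. D = Thm. 5.1.3 (PRE); [LiuZhangZhang2018] Thms. 1.5.1/1.5.3; [Castella2018Exceptional]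
Thms. 2.10–2.11; [Hsieh2014] Thm. 1; [MilneADT2006] I Thm. 4.10; [Mazur1978] Cor. 4.1; [GreenbergVatsal2000] Thm. (1.3);
[CastellaEtAl2021] Thm. 5.3.1; [Miller2011LMS] Def. 1.1; cell memo k5-c4-MEMO-9 (2026-08-27).
-/

set_option autoImplicit false
set_option linter.dupNamespace false

noncomputable section

open scoped Classical MatrixGroups ModularForm

open CongruenceSubgroup WeierstrassCurve NumberField IsDedekindDomain Field PowerSeries
  Literature.NumberTheory.EllipticCurves Literature.NumberTheory.EllipticCurves.GreenbergSelmer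
  Literature.NumberTheory.EllipticCurves.ModularForms Literature.NumberTheory.QuadraticFields
  Literature.NumberTheory.EllipticCurves.Rank1Residual
  Literature.NumberTheory.EllipticCurves.Rank1Residual.Typed
  Literature.NumberTheory.EllipticCurves.GreenbergVatsal2000
  Literature.NumberTheory.EllipticCurves.Wuthrich2014
  Literature.NumberTheory.EllipticCurves.SteinWuthrich2013
  Literature.NumberTheory.EllipticCurves.Castella2018Exceptional
  Literature.NumberTheory.GaloisRepresentations Literature.NumberTheory.GaloisCohomology
  Literature.NumberTheory.Automorphic
  Summit.BirchSwinnertonDyer.Rank1Residual.X2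
  Summit.BirchSwinnertonDyer.Rank1Residual

namespace Summit.BirchSwinnertonDyer.BirchSwinnertonDyer.Theorems.OfPublishedInputs

/-- **Crux 4 `BSDpOnCellC` BY NAME from the route's `PublishedInputs` + the six undeclared published facts + Keller–Yin
Thm. D + crux 3.** Hypotheses: `hP` = the route decl `Theses.EisensteinPrimes.PublishedInputs` (item 19037, 20
conjuncts; eleven of them are used: Cassels, newform existence, Hoffstein–Luo, Gross–Zagier, Kolyvagin, GZK rank,
GV 2000 λ/μ, Wuthrich Thm. 16, Stein–Wuthrich Thm. 6.1 ×2, Greenberg–Stevens); `hPT`, `hPT2` = Poitou–Tate duality for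
Selmer structures / for `Ш¹`–`Ш²` (Milne ADT I 4.10 (b)/(a)); `hH` = Hsieh 2014 Thm. 1; `hMaz` = Mazur 1978 Cor. 4.1;
`hCS` = Castella 2018 Thms. 2.10–2.11 in BDP's display ([cas-split]); `hF` = Liu–Zhang–Zhang 2018 Thms. 1.5.1/1.5.3;
`hD` = Keller–Yin Thm. D (PREPRINT, by name); `hMCB` = crux 3. Conclusion: the route decl `BSDpOnCellC` BY NAME.
Proof: project the eleven conjuncts out of `hP` and call `Reoriented.bsdpOnCellC_of_thm151_thm153_of_thmD_OPEN`.
A `conditional-result`; credits nothing, books nothing.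
[claim: KellerYin2024, status: under-review] [cite: KellerYin2024, Thm. D = Thm. 5.1.3 (arXiv:2402.12781v2 L306–L309)]
[cite: LiuZhangZhang2018, Thm. 1.5.1 and Thm. 1.5.3 (Duke 167 pp. 748–749)]
[cite: Castella2018Exceptional, Thm. 2.10 and Thm. 2.11 (arXiv:1507.04260 pp. 13–14)]
[cite: Hsieh2014, Thm. 1 (arXiv:1112.1580 pp. 3–4)] [cite: MilneADT2006, Ch. I, Thm. 4.10 (a) and (b)]
[cite: Mazur1978, Cor. 4.1] [cite: CastellaEtAl2021, Thm. 5.3.1] [cite: Miller2011LMS, Def. 1.1] -/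
theorem bsdpOnCellC_of_publishedInputs_of_sixFacts_of_thmD_OPEN
    (hP : Summit.BirchSwinnertonDyer.BirchSwinnertonDyer.Theses.EisensteinPrimes.PublishedInputs)
    (hPT : ∀ (K : Type) [Field K] [NumberField K], poitouTate_selmerStructure_duality K)
    (hPT2 : ∀ (K : Type) [Field K] [NumberField K], poitouTate_sha_tateDual K)
    (hH : hsieh2014_exists_anticyclotomicPAdicLFunction)
    (hMaz : mazur_not_dvd_maninConstant_of_odd)
    (hCS : thm210_thm211_bdpDisplay_pNew)
    (hF : LiuZhangZhang2018.thm151_thm153_modularCurve_heegnerVector)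
    (hD : KellerYin2024.thmD_imcMult_exists_isBDPLFunction_isTorsion_charIdeal_eq_OPEN)
    (hMCB : Summit.BirchSwinnertonDyer.BirchSwinnertonDyer.Theses.EisensteinPrimes.MazurMCOnCellB) :
    Summit.BirchSwinnertonDyer.BirchSwinnertonDyer.Theses.EisensteinPrimes.BSDpOnCellC := by
  unfold Summit.BirchSwinnertonDyer.BirchSwinnertonDyer.Theses.EisensteinPrimes.PublishedInputs at hP
  obtain ⟨-, hCassels, -, -, -, hnf, hHL, -, hGZ, hKo, hGZK, -, -, hGV, hWu, hJs, hJn, -, -, hGS⟩ := hP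
  exact Reoriented.bsdpOnCellC_of_thm151_thm153_of_thmD_OPEN
    ⟨⟨hGV, hWu, hJs, hJn, hGS, hnf, hPT, hPT2, hH, hGZ, hKo, hGZK, hHL, hMaz, hCassels⟩, hCS⟩ hF hD hMCB

/-- **The ψ-EVEN strand of crux 4 BY NAME from the route's `PublishedInputs` + the six undeclared published facts +
Keller–Yin Thm. D, with NO crux 3:** `∀ W p, CellC W p → ¬ GVPar W p → BSDp W p` (the twist partner of a ψ-even X2c
curve lies in the CLOSED Greenberg–Vatsal cell X2a, `X2.pPartRankZero_twist_of_not_gvPar`). Same eleven conjuncts of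
`hP`; call `Reoriented.bsdpOnCellCNotGV_of_thm151_thm153_of_thmD_OPEN`. A `conditional-result`; credits nothing.
[claim: KellerYin2024, status: under-review] [cite: KellerYin2024, Thm. D = Thm. 5.1.3 (arXiv:2402.12781v2 L306–L309)]
[cite: LiuZhangZhang2018, Thm. 1.5.1 and Thm. 1.5.3 (Duke 167 pp. 748–749)]
[cite: Castella2018Exceptional, Thm. 2.10 and Thm. 2.11 (arXiv:1507.04260 pp. 13–14)]
[cite: GreenbergVatsal2000, Thm. (1.3) and §2 p. 28] [cite: Hsieh2014, Thm. 1 (arXiv:1112.1580 pp. 3–4)]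
[cite: MilneADT2006, Ch. I, Thm. 4.10 (a) and (b)] [cite: Mazur1978, Cor. 4.1] [cite: CastellaEtAl2021, Thm. 5.3.1]
[cite: Miller2011LMS, Def. 1.1] -/
theorem bsdpOnCellCNotGV_of_publishedInputs_of_sixFacts_of_thmD_OPEN
    (hP : Summit.BirchSwinnertonDyer.BirchSwinnertonDyer.Theses.EisensteinPrimes.PublishedInputs)
    (hPT : ∀ (K : Type) [Field K] [NumberField K], poitouTate_selmerStructure_duality K)
    (hPT2 : ∀ (K : Type) [Field K] [NumberField K], poitouTate_sha_tateDual K)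
    (hH : hsieh2014_exists_anticyclotomicPAdicLFunction)
    (hMaz : mazur_not_dvd_maninConstant_of_odd)
    (hCS : thm210_thm211_bdpDisplay_pNew)
    (hF : LiuZhangZhang2018.thm151_thm153_modularCurve_heegnerVector)
    (hD : KellerYin2024.thmD_imcMult_exists_isBDPLFunction_isTorsion_charIdeal_eq_OPEN) :
    ∀ (W : WeierstrassCurve ℚ) [W.IsElliptic] [W.IsGloballyMinimal] (p : ℕ) [Fact p.Prime],
      CellC W p → ¬ GVPar W p → BSDp W p := by
  unfold Summit.BirchSwinnertonDyer.BirchSwinnertonDyer.Theses.EisensteinPrimes.PublishedInputs at hP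
  obtain ⟨-, hCassels, -, -, -, hnf, hHL, -, hGZ, hKo, hGZK, -, -, hGV, hWu, hJs, hJn, -, -, hGS⟩ := hP
  exact Reoriented.bsdpOnCellCNotGV_of_thm151_thm153_of_thmD_OPEN
    ⟨⟨hGV, hWu, hJs, hJn, hGS, hnf, hPT, hPT2, hH, hGZ, hKo, hGZK, hHL, hMaz, hCassels⟩, hCS⟩ hF hD

end Summit.BirchSwinnertonDyer.BirchSwinnertonDyer.Theorems.OfPublishedInputs

end
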